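import Literature.NumberTheory.Automorphic.ArthurClozelBaseChange
import Literature.NumberTheory.Automorphic.AutomorphicInductionCuspidalUnramified
import Mathlib.Analysis.SpecialFunctions.Pow.Complex

/-!
# Sketch — crux-ideate stmt-Langlands-15138 (`QuadraticWindow.AutomorphicInductionUnramified`),
# round 1, ideator 2: FIRST LEMMAS of the two idea cards (statements only; they elaborate).

* Card `ramification-controlled-descent`: `ControlledGalOrbitDescent` — Arthur–Clozel Ch. 3
  Thm. 4.2 (e) rendered WITH the exceptional set its proof delivers (S = S_∞ ∪ Ram(E/F) ∪ Ram_F(Π)):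
  the constructed cuspidal `P` is unramified at every `v` with `e_v = 1` above which the orbit of
  `Q₁` is unramified, with the orbit relation (1.1) there. It refines the tree's named fact
  `ArthurClozel1989_descent_of_galOrbit` (`descent_of_controlled`) and carries, for the constructed
  `P`, exactly the hypothesis `h51` of
  `automorphicInduction_cyclic_cuspidal_unramified_of_strongLifting_galOrbit`.
* Card `gl1-gamma-rigidity`: `GammaQuotientZeroCount` — the algebra that turns
  "γ(s, P_v ⊗ χ_v) = monomial · γ(s, I(α) ⊗ χ_v)" into "the inverse L-polynomial of P_v ⊗ χ_v IS the
  Euler polynomial of I(α) ⊗ χ_v" (hence degree N, hence P_v unramified with parameter α); and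
  `LatticeOfZeros` — a polynomial in `q^{-s}` with a non-zero root vanishes on an infinite set
  (the q^{-s}-lattice vs Γ-factor independence used to discard archimedean and same-p places).
-/

noncomputable section

open scoped MatrixGroups NumberField Polynomial Classical
open NumberField IsDedekindDomain MeasureTheory Filter Polynomial
open Literature.NumberTheory.Automorphic AdelicGroupData

namespace Summit.Langlands.Langlands.Cruxes.AutomorphicInductionUnramified.Sketch

/-- **Card 1, first lemma (C⁺).** Arthur–Clozel, Ch. 3, Thm. 4.2 (e) with the RAMIFICATION-CONTROLLED
exceptional set of its proof (PDF p. 174: "Let S be a finite set of places containing all ramified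
places … taking f_v unramified for v ∉ S"; p. 179: "the identity of (4.1) and (4.2) implies the
existence of some representation π of G(𝐀) lifted by Π"; Ch. 1 Thm. 4.5, the fundamental lemma for
ALL Hecke functions at an unramified place): the first three conjuncts are VERBATIM the tree's
`ArthurClozel1989_descent_of_galOrbit F E m`; the fourth says that at every finite `v` of `F` with
`e_v = 1` and every `w ∣ v` at whose Galois conjugates `Q₁` has `L²` Satake parameters `β_σ`, the
descended cuspidal `P` is unramified at `v` with an `L²` Satake parameter `α` and
`∑_σ β_σ = α ^ f(w|v)` — literally the conclusion of the hypothesis `h51` of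
`automorphicInduction_cyclic_cuspidal_unramified_of_strongLifting_galOrbit`, for THIS `P`. -/
def ControlledGalOrbitDescent (F E : Type) [Field F] [NumberField F] [Field E] [NumberField E]
    [Algebra F E] (m : ℕ) : Prop :=
  ∀ [IsGalois F E] (_hm : 0 < m) (_hℓ : (Module.finrank F E).Prime)
    (η : Literature.NumberTheory.GaloisRepresentations.HeckeCharacter F)
    (hη : η.IsClassFieldCharacter E)
    (ν : Measure (gl m E).automorphicQuotient) [(gl m E).IsAutomorphicMeasure ν]
    (_hm1 : multiplicity_one_gl m E ν) (hν : IsGalInvariant F ν) (Q₁ : CuspidalAutomorphicRepGL m E ν)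
    (_hQ : ∃ σ : E ≃ₐ[F] E, ¬ Q₁.IsGalStable F hν σ),
    ∃ (μ : Measure (gl (Module.finrank F E * m) F).automorphicQuotient)
      (_ : (gl (Module.finrank F E * m) F).IsAutomorphicMeasure μ)
      (P : CuspidalAutomorphicRepGL (Module.finrank F E * m) F μ),
      IsWeakBaseChangeLiftOfGalOrbit P.1 Q₁ hν ∧ P.twistByFiniteOrderChar η hη.isFiniteOrder = P ∧
        (∀ P' : CuspidalAutomorphicRepGL (Module.finrank F E * m) F μ,
          IsWeakBaseChangeLiftOfGalOrbit P'.1 Q₁ hν → P' = P) ∧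
        ∀ (v : HeightOneSpectrum (𝓞 F)) (w : HeightOneSpectrum (𝓞 E)),
          w.asIdeal.under (𝓞 F) = v.asIdeal → v.asIdeal.ramificationIdxIn (𝓞 E) = 1 →
          ∀ β : (E ≃ₐ[F] E) → Multiset ℂ,
            (∀ σ : E ≃ₐ[F] E, ∃ (𝔑 : Ideal (𝓞 E)) (ϖ' : ((σ⁻¹ • w).adicCompletion E)ˣ),
              𝔑 ≠ 0 ∧ ¬ (σ⁻¹ • w).asIdeal ∣ 𝔑 ∧
                HasSatakeParameterAt Q₁.1 (principalCongruenceLevel m E 𝔑) (σ⁻¹ • w) ϖ' (β σ)) →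
            ∃ (𝔫 : Ideal (𝓞 F)) (ϖ : (v.adicCompletion F)ˣ) (α : Multiset ℂ),
              𝔫 ≠ 0 ∧ ¬ v.asIdeal ∣ 𝔫 ∧
                HasSatakeParameterAt P.1 (principalCongruenceLevel (Module.finrank F E * m) F 𝔫) v ϖ α ∧
                ∑ σ : E ≃ₐ[F] E, β σ = α.map (· ^ w.asIdeal.inertiaDeg (𝓞 F))

/-- The controlled rendering refines the tree's a.e. rendering of Thm. 4.2 (e). -/
theorem descent_of_controlled {F E : Type} [Field F] [NumberField F] [Field E] [NumberField E]
    [Algebra F E] {m : ℕ} (h : ControlledGalOrbitDescent F E m) :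
    ArthurClozel1989_descent_of_galOrbit F E m := by
  intro _ hm hℓ η hη ν _ hm1 hν Q₁ hQ
  obtain ⟨μ, hμ, P, h1, h2, h3, -⟩ := h hm hℓ η hη ν hm1 hν Q₁ hQ
  exact ⟨μ, hμ, P, h1, h2, h3⟩

/-- **Card 2, first lemma (pure algebra, Lean-provable).** If the inverse local `L`-polynomial `Q`
of `P_v ⊗ χ_v` (`Q(0) = 1`, `deg Q ≤ N`, Godement–Jacquet) satisfies the cleared-denominator form
of `γ(s, P_v ⊗ χ_v, ψ) = (monomial) · γ(s, I(α) ⊗ χ_v, ψ)` — namely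
`X^{M₁} · Q · ∏_{a ∈ α} (1 - q a c X) = C · X^{M₂} · R · ∏_{a ∈ α} (1 - a c X)` for the reversed
dual polynomial `R`, `c = χ_v(ϖ)`, `q = q_v` — and `α` (card `N`, non-zero entries) has NO
`q`-linked pair (`a ≠ q a'`, the Jacquet–Shalika bound on the induced parameter), then
`Q = ∏_{a ∈ α} (1 - a c X)`: the factors `1 - a c X` are coprime to `X^{M₁} ∏ (1 - q a c X)`, so
`∏ (1 - a c X) ∣ Q`, and degrees + `Q(0) = 1` force equality.  In particular `deg Q = N`. -/
def GammaQuotientZeroCount : Prop :=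
  ∀ (q c C : ℂ) (α : Multiset ℂ) (Q R : ℂ[X]) (M₁ M₂ : ℕ),
    q ≠ 0 → c ≠ 0 → C ≠ 0 → (∀ a ∈ α, a ≠ 0) → (∀ a ∈ α, ∀ a' ∈ α, a ≠ q * a') →
    Q.eval 0 = 1 → Q.natDegree ≤ Multiset.card α →
    X ^ M₁ * Q * (α.map fun a => (1 - Polynomial.C (q * a * c) * X)).prod =
      Polynomial.C C * X ^ M₂ * R * (α.map fun a => (1 - Polynomial.C (a * c) * X)).prod →
    Q = (α.map fun a => (1 - Polynomial.C (a * c) * X)).prod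

/-- **Card 2, second lemma (Lean-provable): the `q^{-s}`-lattice.** A polynomial with a non-zero
root, evaluated at `q^{-s}` (`q > 1`), vanishes at infinitely many `s` (one vertical lattice
`s₀ + 2πiℤ/log q` per root) — whereas a finite product of `Γ(a s + b)^{±1}` times an exponential has
its zeros and poles on finitely many horizontal rays; so a rational function of `q_v^{-s}` equal to
such a product has neither zeros nor poles on `ℂ^×`, i.e. is a monomial. -/
def LatticeOfZeros : Prop :=
  ∀ (q : ℝ) (P : ℂ[X]) (z : ℂ), 1 < q → z ≠ 0 → P ≠ 0 → P.IsRoot z →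
    Set.Infinite {s : ℂ | P.eval ((q : ℂ) ^ (-s)) = 0}

end Summit.Langlands.Langlands.Cruxes.AutomorphicInductionUnramified.Sketch

end
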